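import Literature.Barriers.Parity.SiegelZeroDichotomyChowlaStep5
import Literature.Barriers.Parity.SiegelZeroDichotomyChowlaLemma37
import HarnessLib

/-!
# Step (v) of Tao–Teräväinen at `k = 0`: Proposition 8.1 — DISCHARGED

Topic `Literature/Barriers/Parity`; a file of the proof DAG of
`Literature.Barriers.Parity.TaoTeravainen2021_chowla` (Tao–Teräväinen 2022, Corollary 1.8 (ii);
see `SiegelZeroDichotomyChowla.lean`). The named fact `TaoTeravainen2021_prop81_k0` (Proposition 8.1
at `k = 0`, `ℓ ≥ 1`: `𝔼_{n ≤ x} ∏ⱼ λ♯_Siegel(n+h'ⱼ) = O(log^{-1/10} η)`) was reduced in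
`SiegelZeroDichotomyChowlaStep5.lean` (`TaoTeravainen2021_prop81_k0_of_lemma37`) to Lemma 3.7 at
`k = 0` (`TaoTeravainen2021_lemma37_k0`), which is now proved in the tree
(`SiegelZeroDichotomyChowlaLemma37.lean`: the Weil bound by Stepanov's method, the Chinese
remainder theorem and completion of sums). This file records the discharge.
[cite: TaoTeravainen2021, Proposition 8.1 and Lemma 3.7]
-/

namespace Literature.Barriers.Parity

/-- **Tao–Teräväinen 2022, Proposition 8.1 at `k = 0` — PROVED** (step (v) of the main argument,
the "easy case `ℓ > 0`", from Lemma 3.7 via `TaoTeravainen2021_prop81_k0_of_lemma37`).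
[cite: TaoTeravainen2021, Proposition 8.1] -/
theorem TaoTeravainen2021_prop81_k0_holds : TaoTeravainen2021_prop81_k0 :=
  TaoTeravainen2021_prop81_k0_of_lemma37 TaoTeravainen2021_lemma37_k0_holds

end Literature.Barriers.Parity
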